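import Summits.FinalStateConjecture.FinalStateConjecture.Theorems.SwallowTheDatumSubdataDevelopmentsEmbedDoDTilt

/-!
# Route SwallowTheDatum · item `SubdataDevelopmentsEmbed` (stmt-FinalStateConjecture-10053) —
# towards the domain of dependence of the sub-datum (`hcauchy`), V(b): the ENDPOINT LEMMA — a
# future timelike curve lies in the chronological future of its past endpoint

The hypothesis `hEp` of the soft assembly `exists_opens_isCauchyHypersurface_of_localDoD`
(`…DoDAssembly.lean`): if a future timelike curve `γ` on an interval `s` has the past endpoint
`e` (`γ t → e` as `t` decreases through `s`), then `γ t ∈ I⁺(e)` for every `t ∈ s` which is not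
the least parameter; and the time dual `hEf`. Proof: by the translated tilt of
`…DoDTilt.lean` (`exists_nhds_translate_tilt`), whose endpoint `φ⁻¹(C b)` tends to `γ b` as
`κ → 0`, `a → -end`, hence lies in the open set `I⁻(γ t)` for `b < t`, so that
`e ≪ φ⁻¹(C b) ≪ γ t`. O'Neill 1983, Ch. 14, Lemma 3 and time duality (p. 402).

No definition, no named fact.
-/

noncomputable section

open Function Set Filter Topology TopologicalSpace Bundle Manifold
open scoped Manifold ContDiff Topology

namespace Summit.FinalStateConjecture.FinalStateConjecture.Theorems

namespace SubdataDevelopmentsEmbed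

open Literature.Geometry.Lorentzian

section Endpoint

variable {E : Type*} [NormedAddCommGroup E] [NormedSpace ℝ E] {H : Type*} [TopologicalSpace H]
  {I : ModelWithCorners ℝ E H} {n : ℕ∞ω} {M : Type*} [TopologicalSpace M] [ChartedSpace H M]
  [IsManifold I ∞ M] {g : LorentzianMetric I n M} {τ : TimeOrientation g}

/-! ### Reversing the parameter on an arbitrary parameter set -/

/-- **Time reversal of a future timelike curve on any parameter set**: `t ↦ γ(-t)` is a future
timelike curve for `τ.reverse` on the reflected parameter set (velocity `-γ'`). O'Neill 1983,
Ch. 14, p. 402 (time duality); cf. `IsFutureTimelikeCurveOn.reverseParam` for `[a, b]`. -/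
theorem isFutureTimelikeCurveOn_comp_neg {γ : ℝ → M} {s : Set ℝ}
    (hγ : g.IsFutureTimelikeCurveOn τ γ s) :
    g.IsFutureTimelikeCurveOn τ.reverse (fun t ↦ γ (-t)) (Neg.neg ⁻¹' s) := by
  intro u hu
  obtain ⟨hd, ht, hf⟩ := hγ (-u) hu
  have hφ : HasDerivAt (fun t : ℝ ↦ -t) (-1) u := hasDerivAt_neg' u
  obtain ⟨hd', hv⟩ := LorentzianMetric.mdifferentiableAt_comp_of_hasDerivAt (γ := γ) hd hφ
  rw [show velocity I ((fun t ↦ γ t) ∘ fun t ↦ -t) u = velocity I (fun t ↦ γ (-t)) u from rfl,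
    neg_one_smul] at hv
  refine ⟨hd', ?_, ?_⟩
  · rw [hv, LorentzianMetric.isTimelike_neg_iff]
    exact ht
  · rw [hv, TimeOrientation.isFutureDirected_reverse_iff,
      ← TimeOrientation.isFutureDirected_neg_iff, neg_neg]
    exact hf

/-! ### Endpoints of curves on sets with an extremal parameter -/

omit [IsManifold I ∞ M] in
/-- A curve on a parameter set with least element `t₀` has the past endpoint `γ t₀`. -/
theorem hasPastEndpoint_of_isLeast {γ : ℝ → M} {s : Set ℝ} {t₀ : ℝ} (h : IsLeast s t₀) :
    HasPastEndpoint γ s (γ t₀) := by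
  rw [hasPastEndpoint_congr_set (s' := Icc t₀ t₀) h.1 (left_mem_Icc.2 le_rfl)
    (fun t ht ↦ ⟨fun hts ↦ ⟨h.2 hts, ht⟩, fun htI ↦ by
      rw [le_antisymm ht htI.1]; exact h.1⟩)]
  exact hasPastEndpoint_Icc γ le_rfl

omit [IsManifold I ∞ M] in
/-- A curve on a parameter set with greatest element `t₀` has the future endpoint `γ t₀`. -/
theorem hasFutureEndpoint_of_isGreatest {γ : ℝ → M} {s : Set ℝ} {t₀ : ℝ} (h : IsGreatest s t₀) :
    HasFutureEndpoint γ s (γ t₀) := by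
  rw [hasFutureEndpoint_congr_set (s' := Icc t₀ t₀) h.1 (left_mem_Icc.2 le_rfl)
    (fun t ht ↦ ⟨fun hts ↦ ⟨ht, h.2 hts⟩, fun htI ↦ by
      rw [le_antisymm htI.2 ht]; exact h.1⟩)]
  exact hasFutureEndpoint_Icc γ le_rfl

omit [IsManifold I ∞ M] in
/-- Past endpoints are unique (Hausdorff). -/
theorem hasPastEndpoint_unique [T2Space M] {γ : ℝ → M} {s : Set ℝ} (hs : s.Nonempty) {e e' : M}
    (h : HasPastEndpoint γ s e) (h' : HasPastEndpoint γ s e') : e = e' := by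
  haveI : Nonempty s := hs.to_subtype
  exact tendsto_nhds_unique h h'

omit [IsManifold I ∞ M] in
/-- Future endpoints are unique (Hausdorff). -/
theorem hasFutureEndpoint_unique [T2Space M] {γ : ℝ → M} {s : Set ℝ} (hs : s.Nonempty)
    {e e' : M} (h : HasFutureEndpoint γ s e) (h' : HasFutureEndpoint γ s e') : e = e' := by
  haveI : Nonempty s := hs.to_subtype
  exact tendsto_nhds_unique h h'

/-! ### The endpoint lemma -/

/-- **The endpoint lemma (past endpoints).** On a finite-dimensional Hausdorff manifold without
boundary with a `Cⁿ` (`n ≥ 1`) time-oriented Lorentzian metric, let `γ` be a future timelike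
curve on an interval `s` with the past endpoint `e` (`γ t → e` as `t` decreases through `s`).
Then `γ t ∈ I⁺(e)` for every `t ∈ s` below which `s` has a parameter. Proof in the module
docstring (`exists_nhds_translate_tilt`, openness of `I⁻(γ t)`, transitivity of `≪`). -/
theorem mem_chronologicalFuture_of_hasPastEndpoint [BoundarylessManifold I M]
    [FiniteDimensional ℝ E] [T2Space M] (hn : 1 ≤ n) {γ : ℝ → M} {s : Set ℝ} {e : M}
    (hs : s.OrdConnected) (hγ : g.IsFutureTimelikeCurveOn τ γ s) (he : HasPastEndpoint γ s e)
    {t : ℝ} (ht : t ∈ s) {t' : ℝ} (ht' : t' ∈ s) (hlt : t' < t) :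
    γ t ∈ g.chronologicalFuture τ {e} := by
  haveI : Nonempty s := ⟨⟨t, ht⟩⟩
  -- if `s` has a least element `m`, then `e = γ m ≪ γ t`
  by_cases hleast : ∃ m, IsLeast s m
  · obtain ⟨m, hm⟩ := hleast
    have hem : e = γ m := hasPastEndpoint_unique ⟨t, ht⟩ he (hasPastEndpoint_of_isLeast hm)
    have hmt : m < t := lt_of_le_of_lt (hm.2 ht') hlt
    rw [hem]
    exact ⟨γ m, rfl, γ, m, t, hmt, hγ.mono (hs.out hm.1 ht), rfl, rfl⟩
  push Not at hleast
  have hbelow : ∀ r ∈ s, ∃ r' ∈ s, r' < r := by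
    intro r hr
    by_contra hno
    push Not at hno
    exact hleast r ⟨hr, hno⟩
  -- the local data at `e`
  obtain ⟨N, hN, θ, hθ, A, T₀, ℓL, hNsrc, hmain⟩ :=
    exists_nhds_translate_tilt (g := g) (τ := τ) hn e
  -- a parameter `b ≤ t'` below which `γ` stays in `N`
  have hev : ∀ᶠ r : s in atBot, γ r ∈ N ∧ (r : ℝ) ≤ t' :=
    (Filter.Tendsto.eventually_mem he hN).and (eventually_le_atBot (⟨t', ht'⟩ : s))
  obtain ⟨b, hbN⟩ := eventually_atBot.1 hev
  have hbt : (b : ℝ) < t := lt_of_le_of_lt (hbN b le_rfl).2 hlt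
  -- `γ b ≪ γ t`, so `I⁻(γ t)` is an open neighbourhood of `γ b`
  have hγbt : γ t ∈ g.chronologicalFuture τ {γ b} :=
    ⟨γ b, rfl, γ, b, t, hbt, hγ.mono (hs.out b.2 ht), rfl, rfl⟩
  set W : Set M := g.chronologicalPast τ {γ t} with hWdef
  have hWo : IsOpen W := LorentzianMetric.isOpen_chronologicalPast_of_boundaryless g τ _
  have hbW : γ b ∈ W := LorentzianMetric.mem_chronologicalPast_of_mem_chronologicalFuture hγbt
  -- a chart ball around `φ(γ b)` inside `φ(W)`
  have hbsrc : γ b ∈ (extChartAt I e).source := hNsrc (hbN b le_rfl).1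
  set zb : E := extChartAt I e (γ b) with hzbdef
  have hzbt : zb ∈ (extChartAt I e).target := (extChartAt I e).map_source hbsrc
  have hpre : (extChartAt I e).symm ⁻¹' W ∈ 𝓝[(extChartAt I e).target] zb := by
    have hc : ContinuousWithinAt (extChartAt I e).symm (extChartAt I e).target zb :=
      continuousOn_extChartAt_symm e zb hzbt
    refine hc.preimage_mem_nhdsWithin' ?_
    rw [(extChartAt I e).left_inv hbsrc]
    exact mem_nhdsWithin_of_mem_nhds (hWo.mem_nhds hbW)
  obtain ⟨η, hη, hηW⟩ : ∃ η > 0, ∀ y ∈ (extChartAt I e).target, ‖y - zb‖ < η →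
      (extChartAt I e).symm y ∈ W := by
    obtain ⟨O, hO, hOsub⟩ := mem_nhdsWithin_iff_exists_mem_nhds_inter.1 hpre
    obtain ⟨η, hη, hball⟩ := Metric.mem_nhds_iff.1 hO
    exact ⟨η, hη, fun y hyt hy ↦ hOsub ⟨hball (by rwa [Metric.mem_ball, dist_eq_norm]), hyt⟩⟩
  -- the tilt parameter `κ`
  set κ : ℝ := min 1 (η / (2 * (|A| + 1))) with hκdef
  have hκ0 : 0 < κ := lt_min one_pos (by positivity)
  have hκ1 : κ ≤ 1 := min_le_left _ _
  have hκA : κ * A < η := by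
    have h1 : κ ≤ η / (2 * (|A| + 1)) := min_le_right _ _
    have h2 : κ * A ≤ κ * (|A| + 1) := mul_le_mul_of_nonneg_left
      ((le_abs_self A).trans (by linarith)) hκ0.le
    have h3 : κ * (|A| + 1) ≤ η / (2 * (|A| + 1)) * (|A| + 1) :=
      mul_le_mul_of_nonneg_right h1 (by positivity)
    have h4 : η / (2 * (|A| + 1)) * (|A| + 1) = η / 2 := by field_simp
    linarith
  -- a start parameter `a < b` with `φ(γ a)` within `θκ` of `φ e`
  have htend : Tendsto (fun r : s ↦ extChartAt I e (γ r)) atBot (𝓝 (extChartAt I e e)) :=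
    (continuousAt_extChartAt e).tendsto.comp he
  obtain ⟨r₀, hr₀s, hr₀b⟩ := hbelow b b.2
  have hev₂ : ∀ᶠ r : s in atBot, ‖extChartAt I e (γ r) - extChartAt I e e‖ ≤ θ * κ ∧
      (r : ℝ) ≤ r₀ :=
    ((Metric.tendsto_nhds.1 htend (θ * κ) (by positivity)).mono fun r hr ↦ by
      rw [dist_eq_norm] at hr; exact hr.le).and (eventually_le_atBot (⟨r₀, hr₀s⟩ : s))
  obtain ⟨a, haclose, har₀⟩ := hev₂.exists
  have hab : (a : ℝ) < b := lt_of_le_of_lt har₀ hr₀b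
  -- the translated tilted curve from `e`
  have hIcc : ∀ r ∈ Icc (a : ℝ) b, r ∈ s := fun r hr ↦ hs.out a.2 b.2 hr
  obtain ⟨β, hβ, hβa, hβb, hdist, htgt⟩ := hmain γ a b hab (hγ.mono fun r hr ↦ hIcc r hr)
    (fun r hr ↦ (hbN ⟨r, hIcc r hr⟩ (show (⟨r, hIcc r hr⟩ : s) ≤ b from hr.2)).1) κ hκ0 hκ1 haclose
  -- its endpoint lies in `I⁻(γ t)`
  have hyW : β b ∈ W := by
    rw [hβb]
    exact hηW _ htgt (lt_of_le_of_lt hdist hκA)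
  -- `e ≪ β b ≪ γ t`
  have heβ : β b ∈ g.chronologicalFuture τ {e} := ⟨e, rfl, β, a, b, hab, hβ, hβa, rfl⟩
  exact LorentzianMetric.mem_chronologicalFuture_trans heβ
    (LorentzianMetric.mem_chronologicalFuture_of_mem_chronologicalPast hyW)

/-- **The endpoint lemma (future endpoints)**: with `γ`, `s` as above and the future endpoint `e`,
`e ∈ I⁺(γ t)` for every `t ∈ s` above which `s` has a parameter (time dual, through
`isFutureTimelikeCurveOn_comp_neg` and `hasPastEndpoint_comp_neg_iff`). -/
theorem mem_chronologicalFuture_of_hasFutureEndpoint [BoundarylessManifold I M]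
    [FiniteDimensional ℝ E] [T2Space M] (hn : 1 ≤ n) {γ : ℝ → M} {s : Set ℝ} {e : M}
    (hs : s.OrdConnected) (hγ : g.IsFutureTimelikeCurveOn τ γ s) (he : HasFutureEndpoint γ s e)
    {t : ℝ} (ht : t ∈ s) {t' : ℝ} (ht' : t' ∈ s) (hlt : t < t') :
    e ∈ g.chronologicalFuture τ {γ t} := by
  have hs' : (Neg.neg ⁻¹' s).OrdConnected := ⟨fun x hx y hy z hz ↦ by
    have : -z ∈ Icc (-y) (-x) := ⟨neg_le_neg hz.2, neg_le_neg hz.1⟩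
    exact hs.out hy hx this⟩
  have h := mem_chronologicalFuture_of_hasPastEndpoint (τ := τ.reverse) hn hs'
    (isFutureTimelikeCurveOn_comp_neg hγ) (hasPastEndpoint_comp_neg_iff.2 he)
    (t := -t) (by simpa using ht) (t' := -t') (by simpa using ht') (neg_lt_neg hlt)
  simp only [neg_neg] at h
  exact LorentzianMetric.mem_chronologicalFuture_of_mem_chronologicalPast h

end Endpoint

end SubdataDevelopmentsEmbed

end Summit.FinalStateConjecture.FinalStateConjecture.Theorems

end
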